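import Summits.ResolutionOfSingularities.ResolutionOfSingularities.Theorems.FrobeniusLadderFInjectiveMacaulayficationT11Char3Level2Tables
import Summits.ResolutionOfSingularities.ResolutionOfSingularities.Theorems.FrobeniusLadderFInjectiveMacaulayficationT11Char7Poly
import Summits.ResolutionOfSingularities.ResolutionOfSingularities.Theorems.FrobeniusLadderFInjectiveMacaulayficationKLocCellPerm
import Summits.ResolutionOfSingularities.ResolutionOfSingularities.Theorems.FrobeniusLadderFInjectiveMacaulayficationLineBlowupFan4
import HarnessLib

/-!
# T₁₁ at `p = 3`, LEVEL 2 of the E7 two-level tower — kernel checks, fan bridges, `θ`-identities, the translation identity and the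
# level-2 cells on the tables of `…T11Char3Level2Tables` (hon charts `σ ∈ {64, 66}`) — GENERATED
# (crux `FInjectiveMacaulayfication` stmt-ResolutionOfSingularities-15315, chain w45a; res-L1-w45a-plan-1 R13.13 (2)(c);
# res-L1-w45a-lead-1 LEVEL-2 BINDER SHAPE 2026-08-27T13:01:47Z (i)(ii)(iii); texts owner res-L1-w45a-stub-4 gen 5)

Support file for crux stmt-ResolutionOfSingularities-15315 (`FrobeniusLadder.FInjectiveMacaulayfication`), chain w45a.
[OURS · L1 W4.5a] — NOT a statement of any manuscript; AI-written (script-generated, `gen_level2.py` of res-L1-w45a-stub-4), weaker than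
expert review. See the module docstring of `…T11Char3Level2Tables` (certificate `cert-T11-p3-tower.v1.json` sha256/16 `9b80b52d9fdbabd6`) for the
objects. This file: §2 the facts decided in the kernel (`θ`-alignment `hθ_raw`, `hX2_raw`, the relative cover `hcov2`, `SS2_eq`); §3 the
BRIDGES to res-L1-w45a-lead-1's level-2 fan tables `LineBlowupFan4.Fan023/Fan012` (p534860; `V2_eq₀/₁`, `Jc_eq₀/₁`, `jOf_eq₀/₁`,
`dF2_single`) and the centre-ideal equalities `span_A_eq₀/₁` (`(u^b : b ∈ A) = (u_j : j ∈ J)` in `k[u]`, for the (R3b)/`block_of_eq` glue);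
§4 the polynomial binders: `hθF2₀`/`hθF2`/`hθF_single` and the lead-1-facing `hθF₆₄`/`hθF₆₆` (`θ_(V c) f̃_σ = u^(2e_{j₀}) · g₂`,
`CIPolyKit.theta_evalL`), `hX2`/`hg02` at `CharP k 3`, the translation identity `htrans` (`τ f̃_σ = g_σ` in characteristic `3` for any
`k`-algebra map `τ` with `τ u_r = u_r + 1`, `τ u_i = u_i`; from the `ℤ`-identity `htrans_int`, `ring`), and **`cells2`** — ONE `KLocCell`
cell per level-2 chart on the stratum `{j₀}` (`KLocCellKit.klocCells_of_check'`, `p = 3`, one kernel `decide` each) with the covers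
`hcov2` / `hcov₆₄` / `hcov₆₆` = the `hcells`/`hcov` binders of `KLocCellRange.honQuot_of_kLocCells_range 3 K 4 J (V c) ![g₂] …` in lead-1's
level-2 block producer (`CICertificates.ciCertificates` on `k[u]/(f̃_σ)` with the `LineBlowupFan4` fan binders).
No definition, no named fact; no statement of [claim: Hironaka2017] is used. [folklore; cite: Fedder1983, Prop. 1.7 and Thm. 1.12]
-/

-- single-problem summit: the doubled namespace component is forced
set_option linter.dupNamespace false

noncomputable section

namespace Summit.ResolutionOfSingularities.ResolutionOfSingularities.Theorems.FInjectiveMacaulayfication.T11Char3Level2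

open MvPolynomial
open Summit.ResolutionOfSingularities.ResolutionOfSingularities.Theorems.FInjectiveMacaulayfication

/-! ## §2 Raw kernel checks (one `decide` each) -/

/-- `G2θ σ c` is a permutation of `G2 σ c`. [generated check] -/
theorem hG2θ_perm : ∀ (σ : Fin 2) (c : Fin 3), (G2θ σ c).Perm (G2 σ c) := by decide +kernel

/-- The `θ`-factorisation witnesses: termwise `V2 σ c · e = dF2 σ c + e'` with equal coefficients, along `Ft σ` / `G2θ σ c`. [generated check] -/
theorem hθ_raw : ∀ (σ : Fin 2) (c : Fin 3),
    List.Forall₂ (fun t t' : ℤ × (Fin 4 → ℕ) => t.1 = t'.1 ∧ (V2 σ c).mulVec t.2 = dF2 σ c + t'.2) (Ft σ) (G2θ σ c) := by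
  decide +kernel

/-- For every chart and variable, a term of `g₂` free of that variable whose coefficient class is prime to `3`. [generated check] -/
theorem hX2_raw : ∀ (σ : Fin 2) (c : Fin 3) (i : Fin 4), ∃ t ∈ G2 σ c, t.2 i = 0 ∧
    ¬ ((3 : ℤ) ∣ (((G2 σ c).filter fun s : ℤ × (Fin 4 → ℕ) => s.2 = t.2).map fun s : ℤ × (Fin 4 → ℕ) => s.1).sum) := by
  decide +kernel

/-- **`hcov2`** — the level-2 strata cover RELATIVE TO `J`: every zero pattern over `V(u_J)` (= on the exceptional divisor) contains
the chart's stratum `{j₀}`. [generated check] -/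
theorem hcov2 : ∀ (σ : Fin 2) (c : Fin 3) (T : Finset (Fin 4)), (∀ j ∈ Jc σ, ∃ i ∈ T, 0 < V2 σ c i j) → ∃ S ∈ SS2 σ c, S ⊆ T := by
  decide +kernel

/-- `SS2 σ c = [{jOf σ c}]`. [generated check] -/
theorem SS2_eq : ∀ (σ : Fin 2) (c : Fin 3), SS2 σ c = [{jOf σ c}] := by decide +kernel

/-! ## §3 Bridges to res-L1-w45a-lead-1's level-2 fan tables `LineBlowupFan4.Fan023` (σ = 0) / `Fan012` (σ = 1) (p534860), and the
centre ideal `(u_A) = (u_j : j ∈ J)` -/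

/-- `V2 0 = Fan023.V` (same literal matrices). [table check] -/
theorem V2_eq₀ : ∀ c : Fin 3, V2 0 c = LineBlowupFan4.Fan023.V c := by decide +kernel

/-- `V2 1 = Fan012.V`. [table check] -/
theorem V2_eq₁ : ∀ c : Fin 3, V2 1 c = LineBlowupFan4.Fan012.V c := by decide +kernel

/-- `Jc 0 = Fan023.J`. [table check] -/
theorem Jc_eq₀ : Jc 0 = LineBlowupFan4.Fan023.J := by decide +kernel

/-- `Jc 1 = Fan012.J`. [table check] -/
theorem Jc_eq₁ : Jc 1 = LineBlowupFan4.Fan012.J := by decide +kernel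

/-- `jOf 0 = Fan023.jc`. [table check] -/
theorem jOf_eq₀ : ∀ c : Fin 3, jOf 0 c = LineBlowupFan4.Fan023.jc c := by decide +kernel

/-- `jOf 1 = Fan012.jc`. [table check] -/
theorem jOf_eq₁ : ∀ c : Fin 3, jOf 1 c = LineBlowupFan4.Fan012.jc c := by decide +kernel

/-- The exceptional exponent `d2 σ c` is `2 e_{j₀}` as a `Finsupp.single` (the `hd` shape of `LineBlowupFan4.Fan*.hunit`, `μ c = 2`). -/
theorem dF2_single : ∀ (σ : Fin 2) (c : Fin 3), (Finsupp.equivFunOnFinite.symm (dF2 σ c) : Fin 4 →₀ ℕ) = Finsupp.single (jOf σ c) 2 := by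
  intro σ c
  ext i
  simp only [Finsupp.coe_equivFunOnFinite_symm, Finsupp.single_apply]
  fin_cases σ <;> fin_cases c <;> fin_cases i <;> decide

/-- `d2 σ c l = single j₀ 2` (`hd` of `LineBlowupFan4.Fan*.hunit` with `μ = 2`, after `jOf_eq₀/₁`). -/
theorem d2_eq_single : ∀ (σ : Fin 2) (c : Fin 3) (l : Fin 1), d2 σ c l = Finsupp.single (jOf σ c) 2 :=
  fun σ c _ => dF2_single σ c

/-- A monomial ideal whose exponents all involve a variable of `J` and which contains the `u_j`, `j ∈ J`, IS `(u_j : j ∈ J)`. [folklore] -/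
theorem span_monomial_eq_span_X (k : Type) [Field k] (A : Finset (Fin 4 →₀ ℕ)) (J : Finset (Fin 4))
    (hAJ : ∀ x ∈ A, ∃ j ∈ J, 0 < x j) (h1 : ∀ j ∈ J, Finsupp.single j 1 ∈ A) :
    Ideal.span ((fun b : Fin 4 →₀ ℕ => (monomial b (1 : k) : MvPolynomial (Fin 4) k)) '' (A : Set (Fin 4 →₀ ℕ))) =
      Ideal.span ((fun j : Fin 4 => (X j : MvPolynomial (Fin 4) k)) '' (J : Set (Fin 4))) := by
  apply le_antisymm
  · rw [Ideal.span_le]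
    rintro _ ⟨b, hb, rfl⟩
    dsimp only
    obtain ⟨j, hj, hbj⟩ := hAJ b hb
    have hle : Finsupp.single j 1 ≤ b := Finsupp.single_le_iff.mpr (Nat.one_le_iff_ne_zero.mpr (Nat.pos_iff_ne_zero.mp hbj))
    have heq : (monomial b (1 : k) : MvPolynomial (Fin 4) k) = monomial (b - Finsupp.single j 1) (1 : k) * X j := by
      rw [X, monomial_mul, mul_one, tsub_add_cancel_of_le hle]
    rw [heq]
    exact Ideal.mul_mem_left _ _ (Ideal.subset_span ⟨j, hj, rfl⟩)
  · rw [Ideal.span_le]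
    rintro _ ⟨j, hj, rfl⟩
    dsimp only
    have : (X j : MvPolynomial (Fin 4) k) = monomial (Finsupp.single j 1) (1 : k) := by rw [X_pow_eq_monomial.symm.trans (pow_one _)]
    rw [this]
    exact Ideal.subset_span ⟨_, h1 j hj, rfl⟩

/-- `e_j ∈ Fan023.A` for `j ∈ J` (exponent `1`). -/
theorem single_mem_A₀ : ∀ j ∈ LineBlowupFan4.Fan023.J, Finsupp.single j 1 ∈ LineBlowupFan4.Fan023.A := by
  intro j hj
  convert LineBlowupFan4.Fan023.mem_A_of_mem (LineBlowupFan4.Fan023.prim_table j hj) using 1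
  ext i
  simp [Finsupp.single_apply]

/-- `e_j ∈ Fan012.A` for `j ∈ J` (exponent `1`). -/
theorem single_mem_A₁ : ∀ j ∈ LineBlowupFan4.Fan012.J, Finsupp.single j 1 ∈ LineBlowupFan4.Fan012.A := by
  intro j hj
  convert LineBlowupFan4.Fan012.mem_A_of_mem (LineBlowupFan4.Fan012.prim_table j hj) using 1
  ext i
  simp [Finsupp.single_apply]

/-- **The level-2 centre of chart 64 is the line ideal**: `(u^b : b ∈ Fan023.A) = (u₀, u₂, u₃)` in `k[u]` (for lead-1's (R3b) /
`TwoLevelRoadFrame.block_of_eq` glue between `ciCertificates`' `I_A` and `I₂ σ = (span (HS σ)).map mk` after translation). -/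
theorem span_A_eq₀ (k : Type) [Field k] :
    Ideal.span ((fun b : Fin 4 →₀ ℕ => (monomial b (1 : k) : MvPolynomial (Fin 4) k)) '' (LineBlowupFan4.Fan023.A : Set (Fin 4 →₀ ℕ))) =
      Ideal.span ((fun j : Fin 4 => (X j : MvPolynomial (Fin 4) k)) '' (LineBlowupFan4.Fan023.J : Set (Fin 4))) :=
  span_monomial_eq_span_X k _ _ LineBlowupFan4.Fan023.hAJ single_mem_A₀

/-- **The level-2 centre of chart 66 is the line ideal**: `(u^b : b ∈ Fan012.A) = (u₀, u₁, u₂)`. -/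
theorem span_A_eq₁ (k : Type) [Field k] :
    Ideal.span ((fun b : Fin 4 →₀ ℕ => (monomial b (1 : k) : MvPolynomial (Fin 4) k)) '' (LineBlowupFan4.Fan012.A : Set (Fin 4 →₀ ℕ))) =
      Ideal.span ((fun j : Fin 4 => (X j : MvPolynomial (Fin 4) k)) '' (LineBlowupFan4.Fan012.J : Set (Fin 4))) :=
  span_monomial_eq_span_X k _ _ LineBlowupFan4.Fan012.hAJ single_mem_A₁

/-! ## §4 The polynomial binders: `θ`-identities, `hX`, `hg0`, the translation, and the level-2 cells -/

/-- **`hθF2₀`**: `θ_(V2 σ c) f̃_σ = u^(dF2 σ c) · g₂` with `g₂ = KLocCellKit.evalL k (G2 σ c)` (`CIPolyKit.theta_evalL` along the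
aligned list `G2θ σ c`, then `G2θ σ c ~ G2 σ c`). -/
theorem hθF2₀ (k : Type) [Field k] : ∀ (σ : Fin 2) (c : Fin 3),
    aeval (fun j : Fin 4 => ∏ i : Fin 4, (X i : MvPolynomial (Fin 4) k) ^ V2 σ c i j) (KLocCellKit.evalL k (Ft σ)) =
      monomial (d2 σ c 0) (1 : k) * KLocCellKit.evalL k (G2 σ c) := by
  intro σ c
  rw [← T11Char7Poly.evalL_eq_of_perm k (hG2θ_perm σ c)]
  exact CIPolyKit.theta_evalL (V2 σ c) (dF2 σ c) (Ft σ) (G2θ σ c) (hθ_raw σ c)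

/-- **`hθF2`** in the binder shape of `CICertificates.ciCertificates` (`r = 1`, `Fs = ![f̃_σ]`, `gs c = ![g₂]`). -/
theorem hθF2 (k : Type) [Field k] (σ : Fin 2) : ∀ (c : Fin 3) (l : Fin 1),
    aeval (fun j : Fin 4 => ∏ i : Fin 4, (X i : MvPolynomial (Fin 4) k) ^ V2 σ c i j)
        ((![KLocCellKit.evalL k (Ft σ)] : Fin 1 → MvPolynomial (Fin 4) k) l) =
      monomial (d2 σ c l) (1 : k) * (![KLocCellKit.evalL k (G2 σ c)] : Fin 1 → MvPolynomial (Fin 4) k) l := by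
  intro c l
  fin_cases l
  exact hθF2₀ k σ c

/-- **`hθF_single`**: the same with the exceptional exponent written `single j₀ 2`. -/
theorem hθF_single (k : Type) [Field k] (σ : Fin 2) : ∀ (c : Fin 3) (l : Fin 1),
    aeval (fun j : Fin 4 => ∏ i : Fin 4, (X i : MvPolynomial (Fin 4) k) ^ V2 σ c i j)
        ((![KLocCellKit.evalL k (Ft σ)] : Fin 1 → MvPolynomial (Fin 4) k) l) =
      monomial (Finsupp.single (jOf σ c) 2) (1 : k) * (![KLocCellKit.evalL k (G2 σ c)] : Fin 1 → MvPolynomial (Fin 4) k) l := by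
  intro c l
  rw [← d2_eq_single σ c l]
  exact hθF2 k σ c l

/-- **`hθF₆₄`** — lead-1-facing form on `LineBlowupFan4.Fan023` (chart 64): `θ_(Fan023.V c) f̃₆₄ = u^(2 e_{jc c}) · g₂`,
`Fs = ![f̃₆₄]`, `gs c = ![KLocCellKit.evalL k (G2 0 c)]`, `d c l = single (Fan023.jc c) 2` (so `Fan023.hunit 2 d (fun _ => rfl)`). -/
theorem hθF₆₄ (k : Type) [Field k] : ∀ (c : Fin 3) (l : Fin 1),
    aeval (fun j : Fin 4 => ∏ i : Fin 4, (X i : MvPolynomial (Fin 4) k) ^ LineBlowupFan4.Fan023.V c i j)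
        ((![KLocCellKit.evalL k (Ft 0)] : Fin 1 → MvPolynomial (Fin 4) k) l) =
      monomial (Finsupp.single (LineBlowupFan4.Fan023.jc c) 2) (1 : k) * (![KLocCellKit.evalL k (G2 0 c)] : Fin 1 → MvPolynomial (Fin 4) k) l := by
  intro c l
  rw [← V2_eq₀ c, ← jOf_eq₀ c]
  exact hθF_single k 0 c l

/-- **`hθF₆₆`** — the same on `LineBlowupFan4.Fan012` (chart 66). -/
theorem hθF₆₆ (k : Type) [Field k] : ∀ (c : Fin 3) (l : Fin 1),
    aeval (fun j : Fin 4 => ∏ i : Fin 4, (X i : MvPolynomial (Fin 4) k) ^ LineBlowupFan4.Fan012.V c i j)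
        ((![KLocCellKit.evalL k (Ft 1)] : Fin 1 → MvPolynomial (Fin 4) k) l) =
      monomial (Finsupp.single (LineBlowupFan4.Fan012.jc c) 2) (1 : k) * (![KLocCellKit.evalL k (G2 1 c)] : Fin 1 → MvPolynomial (Fin 4) k) l := by
  intro c l
  rw [← V2_eq₁ c, ← jOf_eq₁ c]
  exact hθF_single k 1 c l

/-- **`hcov₆₄`** — the level-2 strata cover on `Fan023` (the `hcov` of `KLocCellRange.honQuot_of_kLocCells_range 3 K 4 Fan023.J (Fan023.V c) …`). -/
theorem hcov₆₄ : ∀ (c : Fin 3) (T : Finset (Fin 4)), (∀ j ∈ LineBlowupFan4.Fan023.J, ∃ i ∈ T, 0 < LineBlowupFan4.Fan023.V c i j) →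
    ∃ S ∈ SS2 0 c, S ⊆ T := by
  decide +kernel

/-- **`hcov₆₆`** — the level-2 strata cover on `Fan012`. -/
theorem hcov₆₆ : ∀ (c : Fin 3) (T : Finset (Fin 4)), (∀ j ∈ LineBlowupFan4.Fan012.J, ∃ i ∈ T, 0 < LineBlowupFan4.Fan012.V c i j) →
    ∃ S ∈ SS2 1 c, S ⊆ T := by
  decide +kernel

/-- **`hX2`**: no variable divides a level-2 strict transform, read in characteristic `3`. -/
theorem hX2 (k : Type) [Field k] [CharP k 3] : ∀ (σ : Fin 2) (c : Fin 3) (i : Fin 4), ¬ (X i ∣ KLocCellKit.evalL k (G2 σ c)) := by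
  intro σ c
  unfold KLocCellKit.evalL
  exact NotDvdOfSupport.forall_not_X_dvd_evalL 3 (G2 σ c) (hX2_raw σ c)

/-- **`hg02`**: the level-2 strict transforms are non-zero in characteristic `3`. -/
theorem hg02 (k : Type) [Field k] [CharP k 3] : ∀ (σ : Fin 2) (c : Fin 3), KLocCellKit.evalL k (G2 σ c) ≠ 0 :=
  fun σ c h => hX2 k σ c 0 (by rw [h]; exact dvd_zero _)

/-- `T11Char7Poly.G 64` is the literal below (kernel-decided, so the 87-entry table is never unfolded by the elaborator). -/
theorem G64_eq : T11Char7Poly.G 64 = [((1 : ℤ), (![0, 0, 0, 0] : Fin 4 → ℕ)), ((3 : ℤ), (![0, 0, 0, 1] : Fin 4 → ℕ)), ((3 : ℤ), (![0, 0, 0, 2] : Fin 4 → ℕ)), ((1 : ℤ), (![0, 0, 0, 3] : Fin 4 → ℕ)), ((1 : ℤ), (![0, 0, 4, 5] : Fin 4 → ℕ)), ((1 : ℤ), (![0, 7, 3, 1] : Fin 4 → ℕ)), ((1 : ℤ), (![2, 0, 0, 0] : Fin 4 → ℕ))] := by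
  decide +kernel

/-- `T11Char7Poly.G 66` is the literal below (kernel-decided, so the 87-entry table is never unfolded by the elaborator). -/
theorem G66_eq : T11Char7Poly.G 66 = [((1 : ℤ), (![0, 0, 0, 0] : Fin 4 → ℕ)), ((3 : ℤ), (![0, 0, 1, 0] : Fin 4 → ℕ)), ((3 : ℤ), (![0, 0, 2, 0] : Fin 4 → ℕ)), ((1 : ℤ), (![0, 0, 3, 0] : Fin 4 → ℕ)), ((1 : ℤ), (![0, 3, 0, 2] : Fin 4 → ℕ)), ((1 : ℤ), (![0, 4, 13, 12] : Fin 4 → ℕ)), ((1 : ℤ), (![2, 0, 0, 0] : Fin 4 → ℕ))] := by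
  decide +kernel

/-- The translation identity over `ℤ`-coefficients, `σ = 0` (chart 64, `r = 3`): `τ f̃ + 3 · D = g₆₄`. [generated identity; `ring`] -/
theorem htrans_int₀ (k : Type) [Field k] (τ : MvPolynomial (Fin 4) k →ₐ[k] MvPolynomial (Fin 4) k)
    (h3 : τ (X 3) = X 3 + 1) (h0 : τ (X 0) = X 0) (h1 : τ (X 1) = X 1) (h2 : τ (X 2) = X 2) :
    τ (KLocCellKit.evalL k (Ft 0)) + 3 * KLocCellKit.evalL k (Dt 0) = KLocCellKit.evalL k (T11Char7Poly.G (cOf 0)) := by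
  simp only [cOf, Ft, Dt, Matrix.cons_val_zero, G64_eq, KLocCellKit.evalL, List.map_cons, List.map_nil, List.sum_cons,
    List.sum_nil, T11Char7Poly.monomial_four, Int.cast_one, Int.cast_ofNat, Int.cast_neg, map_one, map_ofNat, map_neg, map_add,
    map_mul, map_pow, map_zero, h0, h1, h2, h3]
  ring

/-- The translation identity over `ℤ`-coefficients, `σ = 1` (chart 66, `r = 2`): `τ f̃ + 3 · D = g₆₆`. [generated identity; `ring`] -/
theorem htrans_int₁ (k : Type) [Field k] (τ : MvPolynomial (Fin 4) k →ₐ[k] MvPolynomial (Fin 4) k)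
    (h2 : τ (X 2) = X 2 + 1) (h0 : τ (X 0) = X 0) (h1 : τ (X 1) = X 1) (h3 : τ (X 3) = X 3) :
    τ (KLocCellKit.evalL k (Ft 1)) + 3 * KLocCellKit.evalL k (Dt 1) = KLocCellKit.evalL k (T11Char7Poly.G (cOf 1)) := by
  simp only [cOf, Ft, Dt, Matrix.cons_val_one, Matrix.cons_val_zero, G66_eq, KLocCellKit.evalL, List.map_cons,
    List.map_nil, List.sum_cons, List.sum_nil, T11Char7Poly.monomial_four, Int.cast_one, Int.cast_ofNat, Int.cast_neg, map_one,
    map_ofNat, map_neg, map_add, map_mul, map_pow, map_zero, h0, h1, h2, h3]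
  ring

/-- The translation identity over `ℤ`-coefficients: `τ f̃_σ + 3 · D_σ = g_σ` for any `k`-algebra endomorphism `τ` of `k[u]` with
`τ u_r = u_r + 1` (`r = trC σ`) and `τ u_i = u_i` otherwise. -/
theorem htrans_int (k : Type) [Field k] (σ : Fin 2) (τ : MvPolynomial (Fin 4) k →ₐ[k] MvPolynomial (Fin 4) k)
    (hτ : τ (X (trC σ)) = X (trC σ) + 1) (hτ' : ∀ i : Fin 4, i ≠ trC σ → τ (X i) = X i) :
    τ (KLocCellKit.evalL k (Ft σ)) + 3 * KLocCellKit.evalL k (Dt σ) = KLocCellKit.evalL k (T11Char7Poly.G (cOf σ)) := by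
  fin_cases σ
  · exact htrans_int₀ k τ hτ (hτ' 0 (by decide)) (hτ' 1 (by decide)) (hτ' 2 (by decide))
  · exact htrans_int₁ k τ hτ (hτ' 0 (by decide)) (hτ' 1 (by decide)) (hτ' 3 (by decide))

/-- **`htrans`**: in characteristic `3`, `τ f̃_σ = g_σ` — the translated equation maps back to the level-1 chart equation under the
unit translation `u_r ↦ y_r + 1`. -/
theorem htrans (k : Type) [Field k] [CharP k 3] (σ : Fin 2) (τ : MvPolynomial (Fin 4) k →ₐ[k] MvPolynomial (Fin 4) k)
    (hτ : τ (X (trC σ)) = X (trC σ) + 1) (hτ' : ∀ i : Fin 4, i ≠ trC σ → τ (X i) = X i) :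
    τ (KLocCellKit.evalL k (Ft σ)) = KLocCellKit.evalL k (T11Char7Poly.G (cOf σ)) := by
  have h3 : (3 : MvPolynomial (Fin 4) k) = 0 := by
    have h := CharP.cast_eq_zero (MvPolynomial (Fin 4) k) 3
    simpa using h
  have h := htrans_int k σ τ hτ hτ'
  rw [h3, zero_mul, add_zero] at h
  exact h

/-- **`cells2` — the level-2 cells** (one per chart, stratum `{j₀}`, `p = 3`): the `hcells` binder of
`KLocCellRange.honQuot_of_kLocCells_range 3 K 4 (Jc σ) (V2 σ c) ![g₂] (hg02 …) (hX2 …) (SS2 σ c) (hcov2 σ c)` for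
`g₂ = KLocCellKit.evalL K (G2 σ c)`; types σ=0 c=0 empty · σ=0 c=1 const · σ=0 c=2 const · σ=1 c=0 empty · σ=1 c=1 const · σ=1 c=2 const; ONE `decide +kernel` each (order-blind records, t₀ = 0).
[folklore; cite: Fedder1983, Prop. 1.7 and Thm. 1.12] -/
theorem cells2 (K : Type) [Field K] [CharP K 3] : ∀ (σ : Fin 2) (c : Fin 3), ∀ S ∈ SS2 σ c,
    ∃ (L : List ((Fin 4 →₀ ℕ) × MvPolynomial (Fin 4) K)) (rr : List (MvPolynomial (Fin 4) K))
      (t : Fin 4 → MvPolynomial (Fin 4) K) (t₀ : MvPolynomial (Fin 4) K),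
      (L.map Prod.fst).Nodup ∧ (∀ e ∈ L, ∀ i : Fin 4, e.1 i < 3) ∧
      KLocCellKit.evalL K (G2 σ c) ^ (3 - 1) = (L.map fun e => MvPolynomial.monomial e.1 (1 : K) * MvPolynomial.expand 3 e.2).sum ∧
      (1 : MvPolynomial (Fin 4) K) = (List.zipWith (fun r e => r * MvPolynomial.expand 3 e.2) rr L).sum +
        ∑ i ∈ S, t i * MvPolynomial.X i + t₀ * KLocCellKit.evalL K (G2 σ c) := by
  haveI : Fact (Nat.Prime 3) := ⟨by decide⟩
  intro σ c
  fin_cases σ <;> fin_cases c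
  · exact KLocCellKit.klocCells_of_check' K 3 _ _
      ([((({0} : Finset (Fin 4))), ([((![0, 0, 0, 0] : Fin 4 → ℕ), [((1 : ℤ), (![0, 0, 0, 0] : Fin 4 → ℕ))])] : List ((Fin 4 → ℕ) × List (ℤ × (Fin 4 → ℕ)))), (![([] : List (ℤ × (Fin 4 → ℕ))), [], [], []] : Fin 4 → List (ℤ × (Fin 4 → ℕ))), (([] : List (ℤ × (Fin 4 → ℕ)))))] : List (Finset (Fin 4) × List ((Fin 4 → ℕ) × List (ℤ × (Fin 4 → ℕ))) × (Fin 4 → List (ℤ × (Fin 4 → ℕ))) × List (ℤ × (Fin 4 → ℕ))))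
      (by decide) (by decide +kernel)
  · exact KLocCellKit.klocCells_of_check' K 3 _ _
      ([((({2} : Finset (Fin 4))), ([((![2, 0, 2, 0] : Fin 4 → ℕ), [((1 : ℤ), (![0, 0, 0, 0] : Fin 4 → ℕ))])] : List ((Fin 4 → ℕ) × List (ℤ × (Fin 4 → ℕ)))), (![[], [], [((1 : ℤ), (![0, 0, 2, 3] : Fin 4 → ℕ))], []] : Fin 4 → List (ℤ × (Fin 4 → ℕ))), (([] : List (ℤ × (Fin 4 → ℕ)))))] : List (Finset (Fin 4) × List ((Fin 4 → ℕ) × List (ℤ × (Fin 4 → ℕ))) × (Fin 4 → List (ℤ × (Fin 4 → ℕ))) × List (ℤ × (Fin 4 → ℕ))))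
      (by decide) (by decide +kernel)
  · exact KLocCellKit.klocCells_of_check' K 3 _ _
      ([((({3} : Finset (Fin 4))), ([((![0, 0, 0, 2] : Fin 4 → ℕ), [((1 : ℤ), (![0, 0, 0, 0] : Fin 4 → ℕ))])] : List ((Fin 4 → ℕ) × List (ℤ × (Fin 4 → ℕ)))), (![[], [], [], ([] : List (ℤ × (Fin 4 → ℕ)))] : Fin 4 → List (ℤ × (Fin 4 → ℕ))), (([] : List (ℤ × (Fin 4 → ℕ)))))] : List (Finset (Fin 4) × List ((Fin 4 → ℕ) × List (ℤ × (Fin 4 → ℕ))) × (Fin 4 → List (ℤ × (Fin 4 → ℕ))) × List (ℤ × (Fin 4 → ℕ))))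
      (by decide) (by decide +kernel)
  · exact KLocCellKit.klocCells_of_check' K 3 _ _
      ([((({0} : Finset (Fin 4))), ([((![0, 0, 0, 0] : Fin 4 → ℕ), [((1 : ℤ), (![0, 0, 0, 0] : Fin 4 → ℕ))])] : List ((Fin 4 → ℕ) × List (ℤ × (Fin 4 → ℕ)))), (![([] : List (ℤ × (Fin 4 → ℕ))), [], [], []] : Fin 4 → List (ℤ × (Fin 4 → ℕ))), (([] : List (ℤ × (Fin 4 → ℕ)))))] : List (Finset (Fin 4) × List ((Fin 4 → ℕ) × List (ℤ × (Fin 4 → ℕ))) × (Fin 4 → List (ℤ × (Fin 4 → ℕ))) × List (ℤ × (Fin 4 → ℕ))))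
      (by decide) (by decide +kernel)
  · exact KLocCellKit.klocCells_of_check' K 3 _ _
      ([((({1} : Finset (Fin 4))), ([((![2, 1, 0, 2] : Fin 4 → ℕ), [((2 : ℤ), (![0, 0, 0, 0] : Fin 4 → ℕ))])] : List ((Fin 4 → ℕ) × List (ℤ × (Fin 4 → ℕ)))), (![[], ([] : List (ℤ × (Fin 4 → ℕ))), [], []] : Fin 4 → List (ℤ × (Fin 4 → ℕ))), (([] : List (ℤ × (Fin 4 → ℕ)))))] : List (Finset (Fin 4) × List ((Fin 4 → ℕ) × List (ℤ × (Fin 4 → ℕ))) × (Fin 4 → List (ℤ × (Fin 4 → ℕ))) × List (ℤ × (Fin 4 → ℕ))))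
      (by decide) (by decide +kernel)
  · exact KLocCellKit.klocCells_of_check' K 3 _ _
      ([((({2} : Finset (Fin 4))), ([((![0, 0, 2, 0] : Fin 4 → ℕ), [((1 : ℤ), (![0, 0, 0, 0] : Fin 4 → ℕ))])] : List ((Fin 4 → ℕ) × List (ℤ × (Fin 4 → ℕ)))), (![[], [], ([] : List (ℤ × (Fin 4 → ℕ))), []] : Fin 4 → List (ℤ × (Fin 4 → ℕ))), (([] : List (ℤ × (Fin 4 → ℕ)))))] : List (Finset (Fin 4) × List ((Fin 4 → ℕ) × List (ℤ × (Fin 4 → ℕ))) × (Fin 4 → List (ℤ × (Fin 4 → ℕ))) × List (ℤ × (Fin 4 → ℕ))))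
      (by decide) (by decide +kernel)

end Summit.ResolutionOfSingularities.ResolutionOfSingularities.Theorems.FInjectiveMacaulayfication.T11Char3Level2

end
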